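import Summits.RiemannHypothesis.RiemannHypothesis.Theorems.PfPersistenceParityTransfer
import Summits.RiemannHypothesis.RiemannHypothesis.Theorems.PfPersistenceCollarBound
import HarnessLib

/-!
# Handoff idea-3 gen11 — the UNIMODAL REDUCTION of even one-signedness to the parity order
(rh-explicit, authored by the H-P ideation seat `handoff-idea-3` gen11 as deposit g11/UnimodalReduction.lean 010335c3…; landed by handoff-prove-1 gen7 as `Theorems/PfPersistenceUnimodalReduction.lean` (p370205, --supports stmt-RiemannHypothesis-19953 --as helper) with these changes to the deposit and no others: namespace `…Theorems.PfPersistenceUnimodalReduction`; import of `Theorems/PfPersistenceCollarBound` and REMOVAL of the deposit's own copies of `xiEven_neg_arg` / `profile_neg_arg` in favour of that file's landed declarations (gate dedup); the `linter.dupNamespace` option; this provenance clause and the two labels marked ‹paper-level› below (referee r18 asks C1/C2))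

**HONEST FRAMING.  RH-free finite-dimensional linear algebra in the `ParityPair` dialect of
`Theorems/PfPersistenceParityTransfer.lean` (pub-rhpf FAKE SEAT 4).  Every statement PROVED (no `sorry`);
hypotheses are arguments, never asserted for `ζ`.  Nothing here is a proof of anything about the Riemann
Hypothesis and no line suggests one.**

## What is in the tree already (credited, not duplicated)

For a parity pair `D` (odd block `M`, even body/border/corner `P, b, q00`, `ω`, `φ = 𝒲(sin(ω ·))`,
`κ = 2/L`, `β = √2/L`), an even eigenpair `(ε; u0, u)` and an odd eigenpair `(μ, v)`:
`ParityPair.pairing_deriv : (μ − ε) ⟨v, ω • u⟩ = edgeSum(u0,u) ⟨φ, v⟩` and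
`ParityPair.isOddEigen_deriv_of_edgeSum_eq_zero` (zero edge value ⇒ `ε ∈ spec M`).  In profile language
(`PfPersistence.profile`, Connes' basis) `⟨v, ω • u⟩ = ⟨ψ_v, −θ_u'⟩_{L²}` and
`edgeSum = (2/L)^{1/2} θ_u(L/2)` (`profile_edge`).

## What this file adds (PROVED)

* `edgeSum_ne_zero_of_not_oddEigen` : if `ε ∉ spec M` then the edge value of EVERY even eigenvector with
  eigenvalue `ε` is non-zero — the "edge channel" is sealed kinematically below the odd spectrum.
* `edgeSum_pos_of_signs` (**the three-sign lemma**): `ε < μ` (parity order), `ε ∉ spec M`,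
  `0 ≤ ⟨v, ω • u⟩` (shape pairing) and `0 < ⟨φ, v⟩` (edge functional of the odd state) force
  `0 < edgeSum(u0, u)`.  Mirror: `edgeSum_neg_of_signs_oddWins` (`μ < ε` forces `edgeSum < 0`).
* `oneSignedMargin_of_antitoneOn` : an even profile that is non-increasing on `[0, L/2]` with positive edge
  value is one-signed with margin its edge value (pure bookkeeping).
* `oneSignedMargin_of_unimodal` (**UNIMODAL REDUCTION**): for a truncated Weil form at a window
  (`β = √2/L`, `κ = 2/L`), IF the even bottom profile is non-increasing on `[0, L/2]` (U), the shape pairing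
  is `≥ 0` (UP — ‹paper-level; not formalised here:› implied by (U) and odd half-window positivity (P) via the dictionary ⟨v, ω•u⟩ = ⟨ψ_v, −θ_u′⟩ and a discrete-monotonicity argument; in this file (UP) is always an explicit hypothesis `hUP`), the edge functional of the odd bottom
  state is positive (R), and the even bottom level lies strictly below the odd spectrum (W), THEN the even
  bottom profile is one-signed with margin `θ_u(L/2) > 0`.  Converse shape statement
  `not_oneSigned_of_unimodal_oddWins`: under (UP), (R) and a positive central value, the REVERSED order
  `μ < ε ∉ spec M` forces a sign change.  I.e. GIVEN the shape hypotheses, one-signedness of the even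
  ground state at a window IS the parity order there — pub-rhpf's DATA reading (PF.md §16.5, "edge
  channel") as a kinematic theorem with the interior channel replaced by the single-state hypothesis (U).

DATA for (U), (P), (UP), (R), (W) at `a ∈ {0.4, …, 1.2}`, `N = 48`: `handoff/idea-3/g11/` (SINGLE-LINEAGE HP;
PF.md §16.3 for (W)).  (U) is the finite-window shadow of the classical monotonicity of Riemann's `Φ`
(`Φ'(t) < 0` for `t > 0`; Csordas–Norfolk–Varga, Trans. AMS 296 (1986), Thm A (ii)); (R) is an arithmetic
sign: `⟨φ, v⟩ = (L/2)^{1/2} 𝒲(y ↦ ψ_v(y − a))`, prime part `−2√a Σ_{log q<2a} Λ(q) q^{-1/2} ψ_v(log q − a)`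
(DERIVED, checked numerically to 6 digits).  No statement about `ζ` is made in this file.

References: K. Löwner, Math. Z. 38 (1934) 177–216; A. Connes, C. Consani, arXiv:2106.01715, Lemma 2.6;
G. Csordas, T. S. Norfolk, R. S. Varga, Trans. Amer. Math. Soc. 296 (1986) 521–541.
-/

noncomputable section

open Matrix Finset Real

set_option linter.dupNamespace false

namespace Summit.RiemannHypothesis.RiemannHypothesis.Theorems.PfPersistenceUnimodalReduction

open Summit.RiemannHypothesis.RiemannHypothesis.Theorems.PfPersistence (xiEven profile OneSigned OneSignedMargin)
open Summit.RiemannHypothesis.RiemannHypothesis.Theorems.PfPersistenceParityTransfer (ParityPair profile_edge)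

variable {N : ℕ} (D : ParityPair N)

/-! ## §1 The edge value never vanishes below the odd spectrum -/

/-- **PROVED.** If `ε` is not an odd eigenvalue, every even eigenvector `(u0, u)`, `u ≠ 0`, with eigenvalue `ε`
has non-zero edge sum (contrapositive of `isOddEigen_deriv_of_edgeSum_eq_zero`). [folklore] -/
theorem edgeSum_ne_zero_of_not_oddEigen {ε u0 : ℝ} {u : Fin N → ℝ} (hu : D.IsEvenEigen ε u0 u) (hu0 : u ≠ 0)
    (hε : ∀ w : Fin N → ℝ, w ≠ 0 → ¬ D.IsOddEigen ε w) : D.edgeSum u0 u ≠ 0 := fun h0 =>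
  hε _ (D.deriv_ne_zero hu0) (D.isOddEigen_deriv_of_edgeSum_eq_zero hu h0)

/-- **PROVED.** Variant: `ε` strictly below every odd eigenvalue. [folklore] -/
theorem edgeSum_ne_zero_of_lt_oddSpectrum {ε u0 : ℝ} {u : Fin N → ℝ} (hu : D.IsEvenEigen ε u0 u) (hu0 : u ≠ 0)
    (hbelow : ∀ (μ' : ℝ) (w : Fin N → ℝ), w ≠ 0 → D.IsOddEigen μ' w → ε < μ') : D.edgeSum u0 u ≠ 0 :=
  edgeSum_ne_zero_of_not_oddEigen D hu hu0 fun w hw hweig => lt_irrefl ε (hbelow ε w hw hweig)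

/-! ## §2 The three-sign lemma: the sign of the edge value is the parity order -/

/-- **PROVED (THREE-SIGN LEMMA).** Parity order `ε < μ`, `ε ∉ spec M`, shape pairing `0 ≤ ⟨v, ω • u⟩` and
edge functional `0 < ⟨φ, v⟩` force a POSITIVE edge sum. [folklore] -/
theorem edgeSum_pos_of_signs {ε u0 μ : ℝ} {u v : Fin N → ℝ} (hu : D.IsEvenEigen ε u0 u) (hv : D.IsOddEigen μ v)
    (hu0 : u ≠ 0) (hW : ε < μ) (hε : ∀ w : Fin N → ℝ, w ≠ 0 → ¬ D.IsOddEigen ε w)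
    (hUP : 0 ≤ v ⬝ᵥ D.deriv u) (hR : 0 < D.φ ⬝ᵥ v) : 0 < D.edgeSum u0 u := by
  have hne := edgeSum_ne_zero_of_not_oddEigen D hu hu0 hε
  have hp := D.pairing_deriv hu hv
  have hnn : 0 ≤ D.edgeSum u0 u * (D.φ ⬝ᵥ v) := by
    rw [← hp]
    exact mul_nonneg (sub_pos.2 hW).le hUP
  rcases lt_or_gt_of_ne hne with hlt | hgt
  · exact absurd hnn (not_le.2 (mul_neg_of_neg_of_pos hlt hR))
  · exact hgt

/-- **PROVED (mirror).** With the REVERSED order `μ < ε` (and `ε ∉ spec M`) the same two signs force a NEGATIVE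
edge sum. [folklore] -/
theorem edgeSum_neg_of_signs_oddWins {ε u0 μ : ℝ} {u v : Fin N → ℝ} (hu : D.IsEvenEigen ε u0 u)
    (hv : D.IsOddEigen μ v) (hu0 : u ≠ 0) (hW : μ < ε) (hε : ∀ w : Fin N → ℝ, w ≠ 0 → ¬ D.IsOddEigen ε w)
    (hUP : 0 ≤ v ⬝ᵥ D.deriv u) (hR : 0 < D.φ ⬝ᵥ v) : D.edgeSum u0 u < 0 := by
  have hne := edgeSum_ne_zero_of_not_oddEigen D hu hu0 hε
  have hp := D.pairing_deriv hu hv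
  have hnp : D.edgeSum u0 u * (D.φ ⬝ᵥ v) ≤ 0 := by
    rw [← hp]
    exact mul_nonpos_of_nonpos_of_nonneg (sub_neg.2 hW).le hUP
  rcases lt_or_gt_of_ne hne with hlt | hgt
  · exact hlt
  · exact absurd hnp (not_le.2 (mul_pos hgt hR))

/-- **PROVED.** The bottom-level form of the three-sign lemma: `μ` the least odd eigenvalue and `ε < μ`. [folklore] -/
theorem edgeSum_pos_of_parityOrder {ε u0 μ : ℝ} {u v : Fin N → ℝ} (hu : D.IsEvenEigen ε u0 u)
    (hv : D.IsOddEigen μ v) (hu0 : u ≠ 0) (hW : ε < μ)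
    (hbot : ∀ (μ' : ℝ) (w : Fin N → ℝ), w ≠ 0 → D.IsOddEigen μ' w → μ ≤ μ')
    (hUP : 0 ≤ v ⬝ᵥ D.deriv u) (hR : 0 < D.φ ⬝ᵥ v) : 0 < D.edgeSum u0 u :=
  edgeSum_pos_of_signs D hu hv hu0 hW (fun w hw hweig => (lt_irrefl ε) (hW.trans_le (hbot ε w hw hweig))) hUP hR

/-! ## §3 Profiles: a non-increasing even profile with positive edge value is one-signed with margin -/

-- `xiEven_neg_arg` / `profile_neg_arg` (even basis functions / even profiles are even) are the landed
-- declarations of `Theorems/PfPersistenceCollarBound.lean` (namespace `…PfPersistence.CollarBound`), reused below.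

/-- **PROVED.** If the profile is non-increasing on `[0, L/2]` and its edge value is positive, it is one-signed on
the window with margin the edge value. [folklore] -/
theorem oneSignedMargin_of_antitoneOn {L : ℝ} (hL : 0 < L) {N : ℕ} {u : Fin (N + 1) → ℝ}
    (hU : AntitoneOn (profile L u) (Set.Icc 0 (L / 2))) (hθ : 0 < profile L u (L / 2)) :
    OneSignedMargin L (profile L u (L / 2)) u := by
  left
  intro x hx
  have h1 : profile L u x = profile L u |x| := by
    rcases le_or_gt 0 x with h | h
    · rw [abs_of_nonneg h]
    · rw [abs_of_neg h, Summit.RiemannHypothesis.RiemannHypothesis.Theorems.PfPersistence.CollarBound.profile_neg_arg]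
  rw [h1]
  have habs : |x| ∈ Set.Icc (0 : ℝ) (L / 2) := ⟨abs_nonneg x, abs_le.2 ⟨by linarith [hx.1], hx.2⟩⟩
  have hend : L / 2 ∈ Set.Icc (0 : ℝ) (L / 2) := ⟨by linarith, le_rfl⟩
  have _ := hθ
  exact hU habs hend habs.2

/-- PROVED: one-signed with a positive margin ⇒ one-signed. [folklore] -/
theorem oneSigned_of_oneSignedMargin {L m : ℝ} (hm : 0 ≤ m) {N : ℕ} {u : Fin (N + 1) → ℝ}
    (h : OneSignedMargin L m u) : OneSigned L u := by
  rcases h with h | h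
  · exact Or.inl fun x hx => hm.trans (h x hx)
  · exact Or.inr fun x hx => (h x hx).trans (neg_nonpos.2 hm)

/-! ## §4 Assembly: the unimodal reduction at a window -/

/-- **PROVED.** For a parity pair with the window constants `β = √2/L`, `κ = 2/L`, the edge value of the profile
of the full even coefficient vector `U = (u0, u)` is `(L/2)^{1/2}`… precisely `√L/√2` times the edge sum. [folklore] -/
theorem profile_edge_eq_edgeSum {L : ℝ} (hL : 0 < L) (hβ : D.β = Real.sqrt 2 / L) (hκ : D.κ = 2 / L)
    (U : Fin (N + 1) → ℝ) :
    profile L U (L / 2) = Real.sqrt L / Real.sqrt 2 * D.edgeSum (U 0) (fun j : Fin N => U j.succ) := by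
  rw [profile_edge hL, ParityPair.edgeSum, hβ, hκ]
  set S : ℝ := ∑ j : Fin N, U j.succ with hS
  have h2 : (0 : ℝ) < Real.sqrt 2 := Real.sqrt_pos.2 (by norm_num)
  have hLs : (0 : ℝ) < Real.sqrt L := Real.sqrt_pos.2 hL
  have hsq : Real.sqrt L * Real.sqrt L = L := Real.mul_self_sqrt hL.le
  have hsq2 : Real.sqrt 2 * Real.sqrt 2 = 2 := Real.mul_self_sqrt (by norm_num)
  have e0 : Real.sqrt 2 / L * (Real.sqrt 2 * S) = 2 / L * S := by
    rw [show Real.sqrt 2 / L * (Real.sqrt 2 * S) = Real.sqrt 2 * Real.sqrt 2 / L * S by ring, hsq2]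
  have e1 : Real.sqrt 2 / L * U 0 + 2 / L * S = Real.sqrt 2 / L * (U 0 + Real.sqrt 2 * S) := by
    rw [mul_add, e0]
  have e2 : Real.sqrt L / Real.sqrt 2 * (Real.sqrt 2 / L) = 1 / Real.sqrt L := by
    rw [div_mul_div_comm, mul_comm (Real.sqrt L) (Real.sqrt 2), mul_div_mul_left _ _ h2.ne',
      div_eq_div_iff hL.ne' hLs.ne', one_mul]
    exact hsq
  rw [e1, ← mul_assoc, e2]
  ring

/-- **PROVED (UNIMODAL REDUCTION).** Window constants `β = √2/L`, `κ = 2/L`; even bottom eigenpair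
`(ε; U 0, U ∘ succ)` of the bordered even block, odd eigenpair `(μ, v)`; (W) `ε < μ` and `ε ∉ spec M`;
(UP) `0 ≤ ⟨v, ω • u⟩`; (R) `0 < ⟨φ, v⟩`; (U) the even profile non-increasing on `[0, L/2]`.  THEN the even
profile is one-signed with margin its edge value `θ_U(L/2) > 0`. [folklore] -/
theorem oneSignedMargin_of_unimodal {L ε μ : ℝ} (hL : 0 < L) (hβ : D.β = Real.sqrt 2 / L) (hκ : D.κ = 2 / L)
    {U : Fin (N + 1) → ℝ} {v : Fin N → ℝ}
    (hu : D.IsEvenEigen ε (U 0) (fun j : Fin N => U j.succ)) (hv : D.IsOddEigen μ v) (hU0 : (fun j : Fin N => U j.succ) ≠ 0)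
    (hW : ε < μ) (hε : ∀ w : Fin N → ℝ, w ≠ 0 → ¬ D.IsOddEigen ε w)
    (hUP : 0 ≤ v ⬝ᵥ D.deriv (fun j : Fin N => U j.succ)) (hR : 0 < D.φ ⬝ᵥ v)
    (hmono : AntitoneOn (profile L U) (Set.Icc 0 (L / 2))) :
    0 < profile L U (L / 2) ∧ OneSignedMargin L (profile L U (L / 2)) U := by
  have hedge : 0 < D.edgeSum (U 0) (fun j : Fin N => U j.succ) := edgeSum_pos_of_signs D hu hv hU0 hW hε hUP hR
  have hθ : 0 < profile L U (L / 2) := by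
    rw [profile_edge_eq_edgeSum D hL hβ hκ U]
    exact mul_pos (div_pos (Real.sqrt_pos.2 hL) (Real.sqrt_pos.2 (by norm_num))) hedge
  exact ⟨hθ, oneSignedMargin_of_antitoneOn hL hmono hθ⟩

/-- **PROVED.** Corollary: under the same hypotheses the even bottom profile is `OneSigned`. [folklore] -/
theorem oneSigned_of_unimodal {L ε μ : ℝ} (hL : 0 < L) (hβ : D.β = Real.sqrt 2 / L) (hκ : D.κ = 2 / L)
    {U : Fin (N + 1) → ℝ} {v : Fin N → ℝ}
    (hu : D.IsEvenEigen ε (U 0) (fun j : Fin N => U j.succ)) (hv : D.IsOddEigen μ v) (hU0 : (fun j : Fin N => U j.succ) ≠ 0)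
    (hW : ε < μ) (hε : ∀ w : Fin N → ℝ, w ≠ 0 → ¬ D.IsOddEigen ε w)
    (hUP : 0 ≤ v ⬝ᵥ D.deriv (fun j : Fin N => U j.succ)) (hR : 0 < D.φ ⬝ᵥ v)
    (hmono : AntitoneOn (profile L U) (Set.Icc 0 (L / 2))) : OneSigned L U := by
  obtain ⟨hθ, hm⟩ := oneSignedMargin_of_unimodal D hL hβ hκ hu hv hU0 hW hε hUP hR hmono
  exact oneSigned_of_oneSignedMargin hθ.le hm

/-- **PROVED (converse shape statement).** Under (UP), (R), a positive CENTRAL value and the REVERSED order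
`μ < ε ∉ spec M`, the even profile takes both signs on the window (positive at the centre, negative at the
edge): it is NOT one-signed. [folklore] -/
theorem not_oneSigned_of_unimodal_oddWins {L ε μ : ℝ} (hL : 0 < L) (hβ : D.β = Real.sqrt 2 / L)
    (hκ : D.κ = 2 / L) {U : Fin (N + 1) → ℝ} {v : Fin N → ℝ}
    (hu : D.IsEvenEigen ε (U 0) (fun j : Fin N => U j.succ)) (hv : D.IsOddEigen μ v) (hU0 : (fun j : Fin N => U j.succ) ≠ 0)
    (hW : μ < ε) (hε : ∀ w : Fin N → ℝ, w ≠ 0 → ¬ D.IsOddEigen ε w)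
    (hUP : 0 ≤ v ⬝ᵥ D.deriv (fun j : Fin N => U j.succ)) (hR : 0 < D.φ ⬝ᵥ v)
    (hcentre : 0 < profile L U 0) : ¬ OneSigned L U := by
  have hedge : D.edgeSum (U 0) (fun j : Fin N => U j.succ) < 0 :=
    edgeSum_neg_of_signs_oddWins D hu hv hU0 hW hε hUP hR
  have hθ : profile L U (L / 2) < 0 := by
    rw [profile_edge_eq_edgeSum D hL hβ hκ U]
    exact mul_neg_of_pos_of_neg (div_pos (Real.sqrt_pos.2 hL) (Real.sqrt_pos.2 (by norm_num))) hedge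
  have h0 : (0 : ℝ) ∈ Set.Icc (-(L / 2)) (L / 2) := ⟨by linarith, by linarith⟩
  have hE : L / 2 ∈ Set.Icc (-(L / 2)) (L / 2) := ⟨by linarith, le_rfl⟩
  rintro (h | h)
  · exact absurd (h _ hE) (not_le.2 hθ)
  · exact absurd (h _ h0) (not_le.2 hcentre)

end Summit.RiemannHypothesis.RiemannHypothesis.Theorems.PfPersistenceUnimodalReduction
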